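import Summits.KontsevichZagierPeriods.KontsevichZagierPeriods.Theses.FermatIsogeny
import Summits.KontsevichZagierPeriods.KontsevichZagierPeriods.Theorems.GammaHodgeSector.Negative.Canonical
import Literature.NumberTheory.Transcendental.KZRelationsLE

/-!
# Crux `BetaProductSector` (stmt-KontsevichZagierPeriods-3898) — the strategist's typed split
# `BetaProductHodgeType ∧ BetaProductHodgeSector → BetaProductSector` (glue for `route edit --split`)

(Authored by the crux strategist planner-cstrat-stmt-KontsevichZagierPeriods-3898-r1-0 as
`Cruxes/BetaProductSector/SplitGlue.lean`; landed by the line lead of crux 4, main theorem in arrow form as the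
registered stub `betaProductSector_of_hodgeType_of_hodgeSector`, after the length-2 chain line died at level 22 —
`Cruxes/BetaProductSector/Lines/registered.dead.md`.)

Crux 4 of route FermatIsogeny, `BetaProductSector` (Conjecture 1 of Kontsevich–Zagier on the
beta-PRODUCT sector, dimension 2: if `B(a,b)B(e,d) = q·B(a',b')B(e',d')` with `q` real algebraic then
the two product representations on `(0,1)²` are `KZ.Equivalent`), is DECOMPOSED along the
Deligne–Koblitz–Ogus Hodge-type condition of the datum `((a,b),(e,d)) / ((a',b'),(e',d'))` at weight `0`,

  `H(u) :  ({ua} + {ub} − {u(a+b)}) + ({ue} + {ud} − {u(e+d)})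
            = ({ua'} + {ub'} − {u(a'+b')}) + ({ue'} + {ud'} − {u(e'+d')})`

for every `u ≥ 1` coprime to the eight denominators (`{·} = Int.fract`; verbatim the `hodgeSum` of the
tree's `GammaHodgeSector`, `N = N' = 2`, `k = 0`, unrolled), into the two CHILDREN filed with
`route edit --split BetaProductSector` (their `statement`s are the two hypotheses below, verbatim):

* `BetaProductHodgeType` — VALUE ⇒ HODGE TYPE (the transcendence atom, NO Kontsevich–Zagier content):
  if `B(a,b)B(e,d) = q·B(a',b')B(e',d')` with `q` real algebraic, then `H(u)` holds for every admissible
  `u`. This is the `(2,2)`, weight-`0` instance of the Lang–Rohrlich conjecture (every `ℚ̄`-multiplicative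
  relation among Beta values at rational arguments is generated by the standard relations, all of which
  are of Hodge type); its `(1,1)` sub-case `B(a,b) = q·B(a',b')` is the theorem of Wolfart–Wüstholz
  (Koblitz–Rohrlich classes), the genuinely quadratic case is open in print.
* `BetaProductHodgeSector` — Conjecture 1 on the HODGE-TYPE beta-product sector: the crux with `H` as an
  extra hypothesis on the datum (for admissible = non-integer exponents it is the `N = N' = 2`, `k = 0`
  part of `TerasomaMultiplication.GammaHodgeSector`, stmt-3742, which the tree reduces to
  `SelbergAMGM.PositiveCancellation`, stmt-5621, `gammaHodgeSector_of_positiveCancellation_alone`).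

THEOREMS (sorry-free, no new definitions):
* `betaProduct_identity_of_valueEq` — the seam: for representations pinned as in the crux,
  `r.value = r'.value` IS the real identity `B(a,b)B(e,d) = q·(B(a',b')B(e',d'))`
  (`B = ProbabilityTheory.beta`, i.e. `Γ(a)Γ(b)/Γ(a+b)`), by the tree's value formula for pinned cube
  representations (`GammaHodgeSectorNegative.value_of_isCubeBetaRep`, Fubini + Euler's Beta integral) and
  `KZ.IntegralRep.value_constMul` through one congruence move;
* `betaProductSector_of_hodgeType_of_hodgeSector` — **the split glue**
  `BetaProductHodgeType → BetaProductHodgeSector → BetaProductSector` (arrow form over the verbatim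
  statements; feeds the value identity to the first child and its Hodge conclusion to the second);
* `betaProductHodgeSector_of_betaProductSector` — conversely the second child is a sub-case of the crux
  (honesty: the crux is EXACTLY `BetaProductHodgeType`-many instances stronger than its second child).

References: Kontsevich–Zagier 2001 §1.2 (Conjecture 1); Deligne, LNM 900 §7, Thm 7.18 with the
Koblitz–Ogus appendix; Wolfart–Wüstholz, Math. Ann. 273 (1985); Andrews–Askey–Roy 1999 §1.1.
-/

noncomputable section

open MeasureTheory Set
open scoped BigOperators

namespace Summit.KontsevichZagierPeriods.FermatIsogeny.BetaProductSectorSplit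

open Literature.NumberTheory.Transcendental
open Literature.NumberTheory.Transcendental.KZ
open Summit.KontsevichZagierPeriods.GammaHodgeSectorNegative
  (IsCubeBetaRep cubeRep cubeRep_value value_of_isCubeBetaRep)
open Summit.KontsevichZagierPeriods.KontsevichZagierPeriods.Theses.FermatIsogeny (BetaProductSector)

/-! ## The seam: value equality of the pinned pair is the Beta-product identity -/

/-- **Value equality is the Beta identity.** For `r = [(0,1)², x^{a-1}(1-x)^{b-1}y^{e-1}(1-y)^{d-1}]` and
`r' = [(0,1)², q·x^{a'-1}(1-x)^{b'-1}y^{e'-1}(1-y)^{d'-1}]` (pinned as in the crux, positive rational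
exponents, `q` real algebraic), `r.value = r'.value` gives
`B(a,b)·B(e,d) = q·(B(a',b')·B(e',d'))`. [cite: KontsevichZagier2001, §1.1] -/
theorem betaProduct_identity_of_valueEq {a b e d a' b' e' d' : ℚ}
    (ha : 0 < a) (hb : 0 < b) (he : 0 < e) (hd : 0 < d)
    (ha' : 0 < a') (hb' : 0 < b') (he' : 0 < e') (hd' : 0 < d') (q : ℝ) (hq : IsAlgebraic ℚ q)
    (r r' : IntegralRep 2)
    (hrd : r.domain = {x | ∀ i, x i ∈ Set.Ioo (0:ℝ) 1})
    (hri : Set.EqOn r.integrand (fun x => (x 0) ^ ((a:ℝ) - 1) * (1 - x 0) ^ ((b:ℝ) - 1) *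
      (x 1) ^ ((e:ℝ) - 1) * (1 - x 1) ^ ((d:ℝ) - 1)) r.domain)
    (hr'd : r'.domain = {x | ∀ i, x i ∈ Set.Ioo (0:ℝ) 1})
    (hr'i : Set.EqOn r'.integrand (fun x => q * (x 0) ^ ((a':ℝ) - 1) * (1 - x 0) ^ ((b':ℝ) - 1) *
      (x 1) ^ ((e':ℝ) - 1) * (1 - x 1) ^ ((d':ℝ) - 1)) r'.domain)
    (hv : r.value = r'.value) :
    ProbabilityTheory.beta (a:ℝ) b * ProbabilityTheory.beta (e:ℝ) d =
      q * (ProbabilityTheory.beta (a':ℝ) b' * ProbabilityTheory.beta (e':ℝ) d') := by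
  have hpos : ∀ j : Fin 2, 0 < ![a, e] j ∧ 0 < ![b, d] j :=
    Fin.forall_fin_two.2 ⟨⟨ha, hb⟩, ⟨he, hd⟩⟩
  have hpos' : ∀ j : Fin 2, 0 < ![a', e'] j ∧ 0 < ![b', d'] j :=
    Fin.forall_fin_two.2 ⟨⟨ha', hb'⟩, ⟨he', hd'⟩⟩
  -- `r` is pinned as the cube representation of `(![a,e], ![b,d])`
  have hr : IsCubeBetaRep ![a, e] ![b, d] r := by
    refine ⟨hrd, fun t ht => ?_⟩
    rw [hri ht]
    simp only [Fin.prod_univ_two, Matrix.cons_val_zero, Matrix.cons_val_one]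
    ring
  have h1 : r.value = ProbabilityTheory.beta (a:ℝ) b * ProbabilityTheory.beta (e:ℝ) d := by
    rw [value_of_isCubeBetaRep hpos hr]
    simp only [Fin.prod_univ_two, Matrix.cons_val_zero, Matrix.cons_val_one]
  -- `r'` agrees on its domain with `q · cubeRep (![a',e'], ![b',d'])`: one congruence move
  have heq : Equivalent r' ((cubeRep ![a', e'] ![b', d'] hpos').constMul q hq) := by
    refine of_sub_of_mem_relations_of_eqOn ?_ fun t ht => ?_
    · rw [IntegralRep.domain_constMul, hr'd]
      rfl
    · rw [hr'i ht, IntegralRep.integrand_constMul]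
      show _ = q * ∏ j : Fin 2, (t j) ^ ((((![a', e'] : Fin 2 → ℚ) j : ℚ) : ℝ) - 1) *
        (1 - t j) ^ ((((![b', d'] : Fin 2 → ℚ) j : ℚ) : ℝ) - 1)
      simp only [Fin.prod_univ_two, Matrix.cons_val_zero, Matrix.cons_val_one]
      ring
  have h2 : r'.value = q * (ProbabilityTheory.beta (a':ℝ) b' * ProbabilityTheory.beta (e':ℝ) d') := by
    rw [Equivalent.value_eq_holds heq, IntegralRep.value_constMul, cubeRep_value]
    simp only [Fin.prod_univ_two, Matrix.cons_val_zero, Matrix.cons_val_one]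
  rw [← h1, ← h2]
  exact hv

/-! ## The split glue -/

/-- **THE SPLIT GLUE** `BetaProductHodgeType → BetaProductHodgeSector → BetaProductSector`: the value
equality of the crux's pinned pair is the Beta identity (`betaProduct_identity_of_valueEq`), the first
child turns it into the Hodge-type condition of the datum, the second child is the crux under that
condition. [cite: KontsevichZagier2001, §1.2 Conjecture 1] -/
theorem betaProductSector_of_hodgeType_of_hodgeSector : (∀ (a b e d a' b' e' d' : ℚ) (q : ℝ), 0 < a → 0 < b → 0 < e → 0 < d → 0 < a' → 0 < b' → 0 < e' → 0 < d' → IsAlgebraic ℚ q → ProbabilityTheory.beta (a:ℝ) b * ProbabilityTheory.beta (e:ℝ) d = q * (ProbabilityTheory.beta (a':ℝ) b' * ProbabilityTheory.beta (e':ℝ) d') → ∀ u : ℕ, 0 < u → Nat.Coprime u a.den → Nat.Coprime u b.den → Nat.Coprime u e.den → Nat.Coprime u d.den → Nat.Coprime u a'.den → Nat.Coprime u b'.den → Nat.Coprime u e'.den → Nat.Coprime u d'.den → (Int.fract ((u:ℚ) * a) + Int.fract ((u:ℚ) * b) - Int.fract ((u:ℚ) * (a + b))) + (Int.fract ((u:ℚ)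 * e) + Int.fract ((u:ℚ) * d) - Int.fract ((u:ℚ) * (e + d))) = (Int.fract ((u:ℚ) * a') + Int.fract ((u:ℚ) * b') - Int.fract ((u:ℚ) * (a' + b'))) + (Int.fract ((u:ℚ) * e') + Int.fract ((u:ℚ) * d') - Int.fract ((u:ℚ) * (e' + d')))) → (∀ (a b e d a' b' e' d' : ℚ) (q : ℝ), 0 < a → 0 < b → 0 < e → 0 < d → 0 < a' → 0 < b' → 0 < e' → 0 < d' → IsAlgebraic ℚ q → (∀ u : ℕ, 0 < u → Nat.Coprime u a.den → Nat.Coprime u b.den → Nat.Coprime u e.den → Nat.Coprime u d.den → Nat.Coprime u a'.den → Nat.Coprime u b'.den → Nat.Coprime u e'.den → Nat.Coprime u d'.den → (Int.fract ((u:ℚ) * a) + Int.fract ((u:ℚ) * b) - Int.fract ((u:ℚ) * (a + b))) + (Int.fract ((u:ℚ) * e) + Int.fract ((u:ℚ) * d) - Int.fract ((u:ℚ) * (e + d))) = (Int.fract ((u:ℚ) * a') + Int.fract ((u:ℚ) * b') - Int.fract ((u:ℚ) * (a' + b'))) + (Int.fract ((u:ℚ) * e') + Int.fract ((u:ℚ)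 * d') - Int.fract ((u:ℚ) * (e' + d')))) → ∀ (r r' : Literature.NumberTheory.Transcendental.KZ.IntegralRep 2), r.domain = {x | ∀ i, x i ∈ Set.Ioo (0:ℝ) 1} → Set.EqOn r.integrand (fun x => (x 0) ^ ((a:ℝ) - 1) * (1 - x 0) ^ ((b:ℝ) - 1) * (x 1) ^ ((e:ℝ) - 1) * (1 - x 1) ^ ((d:ℝ) - 1)) r.domain → r'.domain = {x | ∀ i, x i ∈ Set.Ioo (0:ℝ) 1} → Set.EqOn r'.integrand (fun x => q * (x 0) ^ ((a':ℝ) - 1) * (1 - x 0) ^ ((b':ℝ) - 1) * (x 1) ^ ((e':ℝ) - 1) * (1 - x 1) ^ ((d':ℝ) - 1)) r'.domain → r.value = r'.value → Literature.NumberTheory.Transcendental.KZ.Equivalent r r') → Summit.KontsevichZagierPeriods.KontsevichZagierPeriods.Theses.FermatIsogeny.BetaProductSector := by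
  intro hT hG a b e d a' b' e' d' q ha hb he hd ha' hb' he' hd' hq r r' hrd hri hr'd hr'i hv
  exact hG a b e d a' b' e' d' q ha hb he hd ha' hb' he' hd' hq
    (hT a b e d a' b' e' d' q ha hb he hd ha' hb' he' hd' hq
      (betaProduct_identity_of_valueEq ha hb he hd ha' hb' he' hd' q hq r r' hrd hri hr'd hr'i hv))
    r r' hrd hri hr'd hr'i hv

/-! ## Honesty: the second child is a sub-case of the crux -/

/-- **`BetaProductSector → BetaProductHodgeSector`**: the Hodge-type hypothesis of the second child is
idle for the crux (so the crux is the second child plus exactly the instances the first child, the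
transcendence atom, supplies). [cite: KontsevichZagier2001, §1.2 Conjecture 1] -/
theorem betaProductHodgeSector_of_betaProductSector (h : BetaProductSector) :
    ∀ (a b e d a' b' e' d' : ℚ) (q : ℝ), 0 < a → 0 < b → 0 < e → 0 < d → 0 < a' → 0 < b' → 0 < e' → 0 < d' → IsAlgebraic ℚ q → (∀ u : ℕ, 0 < u → Nat.Coprime u a.den → Nat.Coprime u b.den → Nat.Coprime u e.den → Nat.Coprime u d.den → Nat.Coprime u a'.den → Nat.Coprime u b'.den → Nat.Coprime u e'.den → Nat.Coprime u d'.den → (Int.fract ((u:ℚ) * a) + Int.fract ((u:ℚ) * b) - Int.fract ((u:ℚ) * (a + b))) + (Int.fract ((u:ℚ) * e) + Int.fract ((u:ℚ) * d) - Int.fract ((u:ℚ) * (e + d))) = (Int.fract ((u:ℚ) * a') + Int.fract ((u:ℚ) * b') - Int.fract ((u:ℚ) * (a' + b'))) + (Int.fract ((u:ℚ) * e') + Int.fract ((u:ℚ) * d') - Int.fract ((u:ℚ) * (e' + d')))) → ∀ (r r' : Literature.NumberTheory.Transcendental.KZ.IntegralRep 2), r.domain = {x | ∀ i, x i ∈ Set.Ioo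 (0:ℝ) 1} → Set.EqOn r.integrand (fun x => (x 0) ^ ((a:ℝ) - 1) * (1 - x 0) ^ ((b:ℝ) - 1) * (x 1) ^ ((e:ℝ) - 1) * (1 - x 1) ^ ((d:ℝ) - 1)) r.domain → r'.domain = {x | ∀ i, x i ∈ Set.Ioo (0:ℝ) 1} → Set.EqOn r'.integrand (fun x => q * (x 0) ^ ((a':ℝ) - 1) * (1 - x 0) ^ ((b':ℝ) - 1) * (x 1) ^ ((e':ℝ) - 1) * (1 - x 1) ^ ((d':ℝ) - 1)) r'.domain → r.value = r'.value → Literature.NumberTheory.Transcendental.KZ.Equivalent r r' := by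
  intro a b e d a' b' e' d' q ha hb he hd ha' hb' he' hd' hq _ r r' hrd hri hr'd hr'i hv
  exact h a b e d a' b' e' d' q ha hb he hd ha' hb' he' hd' hq r r' hrd hri hr'd hr'i hv

end Summit.KontsevichZagierPeriods.FermatIsogeny.BetaProductSectorSplit

end
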